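/-
Copyright (c) 2026 the pub-hodgecm-mathlib formalisation cell (harness21).  Prover seat hodgecm-mathlib-LH4-p02 (g8); item (C3b) named by dealer LH4-plan (g7)
WORD #14 (b) (2026-09-02 15:48:58Z), letters of ★ p851957 (C3a) `UnitaryThreeBorelConjugateCongruencesTrace` (F0P3a-p09 (g9)): the `(ν, w)` normal form.
-/
import Literature.NumberTheory.Automorphic.UnitaryThreeBorelConjugateCongruencesJZero
import HarnessLib

/-!
# Flicker's Prop. 13 in the TRACE frame (`|2| < 1` allowed): the 2-free normal form of the fourth congruence and its regimes

Topic `NumberTheory/Automorphic`; namespace `Literature.NumberTheory.Automorphic.UnitaryGroup`; THEOREMS ONLY (no definition, no instance, no notation, no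
`sorry`; kernel lane).  This is the twin of ★ `UnitaryThreeBorelConjugateCongruencesJZero` for the UNRAMIFIED datum WITHOUT `2 ∈ 𝒪ˣ`
(`UnramifiedLocalConjDatum σ ϖ`: `σ` an isometric involution, `σϖ = ϖ`, `|ϖ| = exp(−1)`, (trace) `b + σb = 1` for an integral `b`).

THE MATHEMATICS [Flicker1998UnitaryFL, Prop. 13 pp. 91–93, Prop. 10 p. 86, in the isotropic basis `u_m^{(y,z)}` of the trace frame].  For the corner element
`h = !![α, 0, β; 0, e, 0; γ, 0, δ]` conjugated by `u = u_m^{(y,z)}` the fourth membership condition of ★ `flickerU_of_rel_inv_mul_mul_mem_unitaryInt_iff` reads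
`|β + z(α − e) + σz(γz + δ − e)| ≤ |t|²`, `t = ϖ^m`, which ★ (C3a) `borel_conj_mem_unitaryInt_iff_of_rel_normForm` prints in the `(ν, w)` NORMAL FORM
`E₄ := B₁ν⁻¹ + (A − b)w + (D − b)σw + νB₂·(wσw)` (`ν = uσu` a `σ`-fixed unit, `w = x + z` on the TRACE FIBRE `w + σw = s`, `s = −yσy`; Flicker's own fourth
equation is the instance `s = 2`, `D = A`, `B₁ = B₂`: `2(A−b) + Bn⁻¹ + nB(1 − x²)`) — the FOURTH EXPRESSION of this file, token-exact.  The `j = 0` structure is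
carried by TWO RELATIONS with a scalar `κ`: `B₁ = κσκ·B₂` and `A − D = (σκ − κ)·B₂` (trace literal: `κ = −π∕b₀`; symmetric literal: `κ = 1`), and the place of `½`
is taken by an integral `b₀` with `b₀ + σb₀ = 1` (symmetric literal `b₀ = ½`).  Put `G := ((D − b)∕B₂ − κ)·s`, `Δ := G − σG` (the anti-fixed DEFECT, a constant
of `τ`), `r := (b₀G + σb₀·σG)∕(κ + σκ)` (`σ`-FIXED), `X := κν⁻¹ + w + r`, `C := r(s + r)` (`σ`-fixed).  Then
* §1 **`E₄ = νB₂·(XσX − C) + σb₀·B₂·Δ`** (`corner_four_eq_mul_norm_sub_trace`, pure `ring` — the `w`-LINEAR TERM CANCELS because `(A−b) − (D−b) = (σκ − κ)B₂`;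
  ★ `quadratic_eq_sq_mul_norm_sub` is `κ = 1`, `b₀ = ½`, `s = 2`: `n⁻¹ + f ↔ κν⁻¹ + 1 + r`, `2g n⁻¹ ↔ σb₀Δν⁻¹`, `c₁ = f² − 1 ↔ C`); (4′) FORCES `|B₂|·|Δ| ≤ |t|²`
  WITHOUT ANY `|2|` (`v_mul_le_sq_of_corner_four_trace`: with `S := E₄∕B₂ = ν(XσX − C) + σb₀Δ` one has `S − σS = (σb₀ + b₀)Δ = Δ` — ★ needed `E − σE = 4gn`);
  hence (4′) ⟺ `|B₂|·|XσX − C| ≤ |t|²` (`corner_four_iff_norm_sub_trace`);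
* §2 the 2-free replacement of ★ `v_fixed_add_anti_le_iff` (which is FALSE at `|2| < 1`): for `σw = w`, `σy = −y`, `|κ| ≤ 1`, `|κ + σκ| = 1`:
  `|κw + y| ≤ ρ ⟺ |w| ≤ ρ ∧ |y| ≤ ρ` (`(κ + σκ)w = (κw + y) + σ(κw + y)`; trace literal: `κ + σκ = −π∕(b₀σb₀)` is a unit BECAUSE `b₀ + σb₀ = 1`), the splitting
  `c = κw + y` of any `c` (`exists_eq_mul_fixed_add_anti`), and ★ `v_mul_map_le_pow_iff` re-keyed to the unramified datum;
* §3 THE REGIMES OF (4′) (the conditions (2′)(3′) are used as they stand — ★ (C3a) `conditions_two_three_iff_of_v_B₂_le`): (R-a) everything ≤ `|t|²` ⇒ (4′);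
  (R-kill) `|B₂|, |B₁|, |t|² < |(A−b)w + (D−b)σw|` ⇒ ¬(4′); (R-norm) `|B₂| = |ϖ^N|`, `N ≤ 2m`, `|Δ| ≤ |ϖ^{2m−N}|`: (4′) ⟺ `|XσX − C| ≤ |ϖ^{2m−N}|`;
  (R-bd) if moreover `|C| ≤ |ϖ^{2m−N}|`: (4′) ⟺ `|X| ≤ |ϖ^{m−[N∕2]}|`, and in the coordinates `w = x + z`, `z + r = κw₀ + y₀` (`σw₀ = w₀`, `σy₀ = −y₀`) this ball is
  the BOX `|ν⁻¹ + w₀| ≤ |ϖ^{m−[N∕2]}| ∧ |x + y₀| ≤ |ϖ^{m−[N∕2]}|` — the shape counted by ★ `UnramifiedQuadraticNormCongruences`; (R-ce) `|ϖ^a| < |C| ≤ |ϖ^{2k}|` and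
  `|XσX − C| ≤ |ϖ^a|` ⇒ `|X| ≤ |ϖ^k|` and `ord C` is EVEN (the norm-residue obstruction; sufficiency is the unramified norm theorem `UnramifiedLocalConjDatum.norm`,
  used by the COUNT files).
HONEST LABEL: HC_CM is proved only modulo the printed citations until rung 0 closes; this file is valuation algebra and proves no letter (count-neutral).

## References
* [Flicker1998UnitaryFL] Y. Z. Flicker, *Elementary proof of the fundamental lemma for a unitary group*, Canad. J. Math. 50 (1998): Prop. 13 pp. 91–93, Prop. 10 p. 86.
* [Serre1979] J.-P. Serre, *Local Fields*, Ch. V §2 (unramified norms).  [Rogawski1990] J. D. Rogawski, *Automorphic Representations of Unitary Groups in Three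
  Variables* (1990), §4.9.
-/

set_option autoImplicit false

open scoped WithZero

namespace Literature.NumberTheory.Automorphic

namespace UnitaryGroup

open Literature.NumberTheory.Automorphic.HermitianLattice (UnramifiedLocalConjDatum)

variable {K : Type*} [Field K] [Valued K ℤᵐ⁰] {ϖ : K} (σ : K →+* K)

/-! ## §1 The fourth congruence: a norm minus a constant, up to the `σb₀`-weighted anti-fixed defect -/

omit [Valued K ℤᵐ⁰] in
/-- **`E₄ = νB₂·(X·X′ − r(s + r)) + b₀′·B₂·(G − G′)`** — the 2-free completion of the norm (pure `ring`; primed letters stand for the `σ`-conjugates):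
`w + w′ = s`, `b₀ + b₀′ = 1`, `B₁ = κκ′B₂`, `A − D = (κ′ − κ)B₂`, `B₂G = (D − b − κB₂)s`, `r(κ + κ′) = b₀G + b₀′G′`, `X = κν⁻¹ + w + r`, `X′ = κ′ν⁻¹ + w′ + r`.
The `w`-linear term cancels because `(A − b) − (D − b) = (κ′ − κ)B₂`; ★ `quadratic_eq_sq_mul_norm_sub` is `κ = κ′ = 1`, `b₀ = b₀′ = ½`, `s = 2`.
[cite: Flicker1998UnitaryFL, Prop. 13 p. 93] -/
theorem corner_four_eq_mul_norm_sub_trace {A D b B₁ B₂ ν w w' s κ κ' b₀ b₀' G G' r : K} (hB₂ : B₂ ≠ 0) (hν : ν ≠ 0) (htr : κ + κ' ≠ 0)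
    (hws : w + w' = s) (hb₀ : b₀ + b₀' = 1) (hB₁ : B₁ = κ * κ' * B₂) (hAD : A - D = (κ' - κ) * B₂) (hG : B₂ * G = (D - b - κ * B₂) * s)
    (hr : r * (κ + κ') = b₀ * G + b₀' * G') :
    B₁ * ν⁻¹ + (A - b) * w + (D - b) * w' + ν * B₂ * (w * w') =
      ν * B₂ * ((κ * ν⁻¹ + w + r) * (κ' * ν⁻¹ + w' + r) - r * (s + r)) + b₀' * B₂ * (G - G') := by
  have hw' : w' = s - w := by rw [← hws]; ring
  have hb₀' : b₀' = 1 - b₀ := by rw [← hb₀]; ring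
  have hD : D = A - (κ' - κ) * B₂ := by rw [← hAD]; ring
  have hr' : r = (b₀ * G + b₀' * G') / (κ + κ') := by rw [← hr, mul_div_cancel_right₀ _ htr]
  have hG' : G = (D - b - κ * B₂) * s / B₂ := by rw [← hG, mul_div_cancel_left₀ _ hB₂]
  rw [hr', hG', hw', hD, hB₁, hb₀']
  field_simp
  ring

omit [Valued K ℤᵐ⁰] in
/-- The shift `r` is `σ`-fixed: `σ` (an involution) permutes the right side of `r(κ + σκ) = b₀G + σb₀·σG`. [cite: Flicker1998UnitaryFL, Prop. 13 p. 93] -/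
theorem map_eq_self_of_mul_trace_eq (hσσ : ∀ y, σ (σ y) = y) {κ b₀ G r : K} (htr : κ + σ κ ≠ 0)
    (hr : r * (κ + σ κ) = b₀ * G + σ b₀ * σ G) : σ r = r := by
  have h := congrArg σ hr
  simp only [map_mul, map_add, hσσ] at h
  have h1 : σ r * (κ + σ κ) = r * (κ + σ κ) := by rw [hr]; linear_combination h
  exact mul_right_cancel₀ htr h1

omit [Valued K ℤᵐ⁰] in
/-- `σX = σκ·ν⁻¹ + σw + r` for `X = κν⁻¹ + w + r`, `σν = ν`, `σr = r`: the second factor of §1 is the CONJUGATE (replaces ★ `map_inv_add_add`).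
[cite: Flicker1998UnitaryFL, Prop. 13 p. 93] -/
theorem map_mul_inv_add_add {κ ν w r : K} (hσν : σ ν = ν) (hσr : σ r = r) : σ (κ * ν⁻¹ + w + r) = σ κ * ν⁻¹ + σ w + r := by
  rw [map_add, map_add, map_mul, map_inv₀, hσν, hσr]

omit [Valued K ℤᵐ⁰] in
/-- The trace-fibre constant `s = w + σw` is `σ`-fixed (`σ` an involution). [cite: Flicker1998UnitaryFL, Prop. 10 p. 86] -/
theorem map_eq_self_of_add_map_eq (hσσ : ∀ y, σ (σ y) = y) {w s : K} (hws : w + σ w = s) : σ s = s := by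
  rw [← hws, map_add, hσσ, add_comm]

/-- **THE ANTI-FIXED PART OF (4′), 2-FREE — Flicker's «we must have `2m ≤ M + N`»**: for the unramified datum, a `σ`-fixed unit `ν`, `w + σw = s`, `b₀ + σb₀ = 1`
and the `j = 0` relations `B₁ = κσκB₂`, `A − D = (σκ − κ)B₂` (`κ + σκ ≠ 0`), the fourth congruence `|E₄| ≤ |t|²` forces `|B₂|·|G − σG| ≤ |t|²`: with
`S := E₄∕B₂ = ν(XσX − C) + σb₀(G − σG)` one has `S − σS = (σb₀ + b₀)(G − σG) = G − σG` (no `|2|`: ★ `v_mul_le_sq_of_condition_four` divided by `4n`).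
[cite: Flicker1998UnitaryFL, Prop. 13 p. 92] -/
theorem v_mul_le_sq_of_corner_four_trace (hd : UnramifiedLocalConjDatum σ ϖ) {A D b B₁ B₂ ν w s κ b₀ G r : K} {m : ℕ} (hB₂ : B₂ ≠ 0)
    (hν : Valued.v ν = 1) (hσν : σ ν = ν) (hws : w + σ w = s) (htr : κ + σ κ ≠ 0) (hb₀ : b₀ + σ b₀ = 1) (hB₁ : B₁ = κ * σ κ * B₂)
    (hAD : A - D = (σ κ - κ) * B₂) (hG : B₂ * G = (D - b - κ * B₂) * s) (hr : r * (κ + σ κ) = b₀ * G + σ b₀ * σ G)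
    (h₄ : Valued.v (B₁ * ν⁻¹ + (A - b) * w + (D - b) * σ w + ν * B₂ * (w * σ w)) ≤ Valued.v (ϖ ^ m) * Valued.v (ϖ ^ m)) :
    Valued.v B₂ * Valued.v (G - σ G) ≤ Valued.v (ϖ ^ m) * Valued.v (ϖ ^ m) := by
  have hν0 : ν ≠ 0 := fun h => by rw [h, map_zero] at hν; exact zero_ne_one hν
  have hσr : σ r = r := map_eq_self_of_mul_trace_eq σ hd.σσ htr hr
  have hσs : σ s = s := map_eq_self_of_add_map_eq σ hd.σσ hws
  have e := corner_four_eq_mul_norm_sub_trace (b := b) hB₂ hν0 htr hws hb₀ hB₁ hAD hG hr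
  rw [← map_mul_inv_add_add σ (κ := κ) (w := w) hσν hσr] at e
  set X : K := κ * ν⁻¹ + w + r with hX
  set R : K := X * σ X - r * (s + r) with hR
  have hσR : σ R = R := by
    simp only [hR, map_sub, map_mul, map_add, hσr, hσs, hd.σσ]; ring
  set S : K := ν * R + σ b₀ * (G - σ G) with hS
  have eS : ν * B₂ * R + σ b₀ * B₂ * (G - σ G) = B₂ * S := by rw [hS]; ring
  rw [e, eS, map_mul] at h₄
  have hσS : σ S = ν * R - b₀ * (G - σ G) := by
    simp only [hS, map_add, map_mul, map_sub, hσν, hσR, hd.σσ]; ring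
  have hδ : G - σ G = S - σ S := by rw [hσS, hS]; linear_combination (-(G - σ G)) * hb₀
  have hvδ : Valued.v (G - σ G) ≤ Valued.v S := by
    rw [hδ]; exact le_trans (Valuation.map_sub _ _ _) (max_le le_rfl (by rw [hd.vσ]))
  exact le_trans (mul_le_mul' le_rfl hvδ) h₄

/-- **(4′) AS A NORM CONGRUENCE** (the defect absorbed; `|b₀| ≤ 1`): under `|B₂|·|G − σG| ≤ |t|²`,
`|E₄| ≤ |t|² ⟺ |B₂|·|XσX − r(s + r)| ≤ |t|²`, `X = κν⁻¹ + w + r` (twin of ★ `condition_four_iff_norm_sub`). [cite: Flicker1998UnitaryFL, Prop. 13 pp. 92–93] -/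
theorem corner_four_iff_norm_sub_trace (hd : UnramifiedLocalConjDatum σ ϖ) {A D b B₁ B₂ ν w s κ b₀ G r : K} {m : ℕ} (hB₂ : B₂ ≠ 0)
    (hν : Valued.v ν = 1) (hσν : σ ν = ν) (hws : w + σ w = s) (htr : κ + σ κ ≠ 0) (hb₀ : b₀ + σ b₀ = 1) (hb₀v : Valued.v b₀ ≤ 1)
    (hB₁ : B₁ = κ * σ κ * B₂) (hAD : A - D = (σ κ - κ) * B₂) (hG : B₂ * G = (D - b - κ * B₂) * s) (hr : r * (κ + σ κ) = b₀ * G + σ b₀ * σ G)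
    (hΔ : Valued.v B₂ * Valued.v (G - σ G) ≤ Valued.v (ϖ ^ m) * Valued.v (ϖ ^ m)) :
    Valued.v (B₁ * ν⁻¹ + (A - b) * w + (D - b) * σ w + ν * B₂ * (w * σ w)) ≤ Valued.v (ϖ ^ m) * Valued.v (ϖ ^ m) ↔
      Valued.v B₂ * Valued.v ((κ * ν⁻¹ + w + r) * σ (κ * ν⁻¹ + w + r) - r * (s + r)) ≤ Valued.v (ϖ ^ m) * Valued.v (ϖ ^ m) := by
  have hν0 : ν ≠ 0 := fun h => by rw [h, map_zero] at hν; exact zero_ne_one hν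
  have hσr : σ r = r := map_eq_self_of_mul_trace_eq σ hd.σσ htr hr
  have e := corner_four_eq_mul_norm_sub_trace (b := b) hB₂ hν0 htr hws hb₀ hB₁ hAD hG hr
  rw [← map_mul_inv_add_add σ (κ := κ) (w := w) hσν hσr] at e
  rw [e]
  have hmain : Valued.v (ν * B₂ * ((κ * ν⁻¹ + w + r) * σ (κ * ν⁻¹ + w + r) - r * (s + r))) =
      Valued.v B₂ * Valued.v ((κ * ν⁻¹ + w + r) * σ (κ * ν⁻¹ + w + r) - r * (s + r)) := by
    rw [map_mul, map_mul, hν, one_mul]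
  have hdef : Valued.v (σ b₀ * B₂ * (G - σ G)) ≤ Valued.v (ϖ ^ m) * Valued.v (ϖ ^ m) := by
    rw [map_mul, map_mul, hd.vσ, mul_assoc]
    exact le_trans (mul_le_mul' hb₀v le_rfl) (by rw [one_mul]; exact hΔ)
  refine ⟨fun h => ?_, fun h => ?_⟩
  · have e2 : ∀ P Q : K, P = (P + Q) - Q := fun P Q => by ring
    rw [← hmain, e2 (ν * B₂ * ((κ * ν⁻¹ + w + r) * σ (κ * ν⁻¹ + w + r) - r * (s + r))) (σ b₀ * B₂ * (G - σ G))]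
    exact le_trans (Valuation.map_sub _ _ _) (max_le h hdef)
  · rw [← hmain] at h
    exact le_trans (Valuation.map_add _ _ _) (max_le h hdef)

/-! ## §2 Valuation tools (2-free) -/

/-- **The `κ`-weighted separation of fixed and anti-fixed parts** (replaces ★ `v_fixed_add_anti_le_iff`, false when `|2| < 1`): for `σ` isometric, `σu = u`, `σy = −y`,
`|κ| ≤ 1` and `|κ + σκ| = 1`: `|κu + y| ≤ ρ ⟺ |u| ≤ ρ ∧ |y| ≤ ρ` (`(κ + σκ)·u = (κu + y) + σ(κu + y)`).  In the trace frame `κ + σκ = −π∕(b₀σb₀)` is a unit because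
`b₀ + σb₀ = 1`. [cite: Flicker1998UnitaryFL, Prop. 13 p. 92] -/
theorem v_mul_fixed_add_anti_le_iff (hvσ : ∀ y, Valued.v (σ y) = Valued.v y) {κ u y : K} (hσu : σ u = u) (hσy : σ y = -y)
    (hκ : Valued.v κ ≤ 1) (htr : Valued.v (κ + σ κ) = 1) (ρ : ℤᵐ⁰) :
    Valued.v (κ * u + y) ≤ ρ ↔ Valued.v u ≤ ρ ∧ Valued.v y ≤ ρ := by
  have hκu : ∀ {ρ' : ℤᵐ⁰}, Valued.v u ≤ ρ' → Valued.v (κ * u) ≤ ρ' := fun h => by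
    rw [map_mul]; exact le_trans (mul_le_mul' hκ h) (by rw [one_mul])
  refine ⟨fun h => ?_, fun h => le_trans (Valuation.map_add _ _ _) (max_le (hκu h.1) h.2)⟩
  have hσ : Valued.v (σ (κ * u + y)) ≤ ρ := by rw [hvσ]; exact h
  have eu : (κ + σ κ) * u = (κ * u + y) + σ (κ * u + y) := by rw [map_add, map_mul, hσu, hσy]; ring
  have hu : Valued.v u ≤ ρ := by
    have := le_trans (Valuation.map_add _ _ _) (max_le h hσ)
    rwa [← eu, map_mul, htr, one_mul] at this
  refine ⟨hu, ?_⟩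
  rw [show y = (κ * u + y) - κ * u by ring]
  exact le_trans (Valuation.map_sub _ _ _) (max_le h (hκu hu))

omit [Valued K ℤᵐ⁰] in
/-- Every `c` splits as `κu + y` with `σu = u`, `σy = −y` once `κ + σκ` is invertible (`u = (c + σc)∕(κ + σκ)`; `σ` an involution) — the coordinates in which
`v_mul_fixed_add_anti_le_iff` reads a ball in `X = κν⁻¹ + x + c` as a box in `(ν⁻¹, x)`. [cite: Flicker1998UnitaryFL, Prop. 13 p. 92] -/
theorem exists_eq_mul_fixed_add_anti (hσσ : ∀ y, σ (σ y) = y) {κ : K} (htr : κ + σ κ ≠ 0) (c : K) :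
    ∃ u y : K, σ u = u ∧ σ y = -y ∧ c = κ * u + y := by
  refine ⟨(c + σ c) / (κ + σ κ), c - κ * ((c + σ c) / (κ + σ κ)), ?_, ?_, by ring⟩
  · rw [map_div₀, map_add, map_add, hσσ, hσσ, add_comm (σ c) c, add_comm (σ κ) κ]
  · rw [map_sub, map_mul, map_div₀, map_add, map_add, hσσ, hσσ, add_comm (σ c) c, add_comm (σ κ) κ]
    field_simp
    ring

/-- **`|X σX| ≤ |ϖ^a| ⟺ |X| ≤ |ϖ^{⌈a∕2⌉}|`** for the unramified datum (★ `v_mul_map_le_pow_iff` re-keyed: only `σ` isometric and `|ϖ| = exp(−1)` are read).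
[cite: Flicker1998UnitaryFL, Prop. 13 p. 92] -/
theorem v_mul_map_le_pow_iff_trace (hd : UnramifiedLocalConjDatum σ ϖ) (X : K) (a : ℕ) :
    Valued.v (X * σ X) ≤ Valued.v (ϖ ^ a) ↔ Valued.v X ≤ Valued.v (ϖ ^ ((a + 1) / 2)) := by
  rw [map_mul, hd.vσ, hd.v_pow, hd.v_pow]
  by_cases hX : X = 0
  · simp only [hX, map_zero, zero_mul, zero_le]
  · have hv0 : Valued.v X ≠ 0 := (Valuation.ne_zero_iff _).2 hX
    rw [← WithZero.exp_log hv0, ← WithZero.exp_add, WithZero.exp_le_exp, WithZero.exp_le_exp]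
    omega

/-! ## §3 The regimes of the fourth congruence

Notation: `E₄ = B₁ν⁻¹ + (A − b)w + (D − b)σw + νB₂·(wσw)` (the fourth expression of ★ `borel_conj_mem_unitaryInt_iff_of_rel_normForm`), `t = ϖ^m`, `ν` a `σ`-fixed unit,
`w` integral on the trace fibre `w + σw = s`. -/

/-- **(R-a) «everything solves»**: if `|A − b|, |D − b|, |B₂|, |B₁| ≤ |t|²` then `|E₄| ≤ |t|²` for every unit `ν` and integral `w` (twin of ★ `conditions_of_le_sq`, fourth condition).
[cite: Flicker1998UnitaryFL, Prop. 13 (a) p. 91, proof p. 93] -/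
theorem corner_four_of_le_sq_trace (hd : UnramifiedLocalConjDatum σ ϖ) {A D b B₁ B₂ ν w : K} {m : ℕ} (hν : Valued.v ν = 1) (hwv : Valued.v w ≤ 1)
    (hs : Valued.v (A - b) ≤ Valued.v (ϖ ^ m) * Valued.v (ϖ ^ m)) (hs' : Valued.v (D - b) ≤ Valued.v (ϖ ^ m) * Valued.v (ϖ ^ m))
    (hB₂ : Valued.v B₂ ≤ Valued.v (ϖ ^ m) * Valued.v (ϖ ^ m)) (hB₁ : Valued.v B₁ ≤ Valued.v (ϖ ^ m) * Valued.v (ϖ ^ m)) :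
    Valued.v (B₁ * ν⁻¹ + (A - b) * w + (D - b) * σ w + ν * B₂ * (w * σ w)) ≤ Valued.v (ϖ ^ m) * Valued.v (ϖ ^ m) := by
  have hσw : Valued.v (σ w) ≤ 1 := by rw [hd.vσ]; exact hwv
  have t1 : Valued.v (B₁ * ν⁻¹) ≤ Valued.v (ϖ ^ m) * Valued.v (ϖ ^ m) := by rw [map_mul, map_inv₀, hν, inv_one, mul_one]; exact hB₁
  have t2 : Valued.v ((A - b) * w) ≤ Valued.v (ϖ ^ m) * Valued.v (ϖ ^ m) := by
    rw [map_mul]; exact le_trans (mul_le_mul' le_rfl hwv) (by rw [mul_one]; exact hs)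
  have t3 : Valued.v ((D - b) * σ w) ≤ Valued.v (ϖ ^ m) * Valued.v (ϖ ^ m) := by
    rw [map_mul]; exact le_trans (mul_le_mul' le_rfl hσw) (by rw [mul_one]; exact hs')
  have t4 : Valued.v (ν * B₂ * (w * σ w)) ≤ Valued.v (ϖ ^ m) * Valued.v (ϖ ^ m) := by
    rw [map_mul, map_mul, hν, one_mul, map_mul]
    exact le_trans (mul_le_mul' le_rfl (mul_le_one' hwv hσw)) (by rw [mul_one]; exact hB₂)
  exact le_trans (Valuation.map_add _ _ _) (max_le (le_trans (Valuation.map_add _ _ _) (max_le (le_trans (Valuation.map_add _ _ _) (max_le t1 t2)) t3)) t4)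

/-- **(R-kill) «no solutions once the linear term dominates»** (twin of ★ `not_condition_four_of_v_lt`; p. 93 «if `N₊ < N`, `2m`, there are no solutions»): if
`|B₂|, |B₁|, |t|² < |(A − b)w + (D − b)σw|` then (4′) fails (for a unit `ν` and integral `w`). [cite: Flicker1998UnitaryFL, Prop. 13 p. 93] -/
theorem not_corner_four_of_v_lt_trace (hd : UnramifiedLocalConjDatum σ ϖ) {A D b B₁ B₂ ν w : K} {m : ℕ} (hν : Valued.v ν = 1) (hwv : Valued.v w ≤ 1)
    (hB₂M : Valued.v B₂ < Valued.v ((A - b) * w + (D - b) * σ w)) (hB₁M : Valued.v B₁ < Valued.v ((A - b) * w + (D - b) * σ w))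
    (htM : Valued.v (ϖ ^ m) * Valued.v (ϖ ^ m) < Valued.v ((A - b) * w + (D - b) * σ w)) :
    ¬ Valued.v (B₁ * ν⁻¹ + (A - b) * w + (D - b) * σ w + ν * B₂ * (w * σ w)) ≤ Valued.v (ϖ ^ m) * Valued.v (ϖ ^ m) := by
  intro h₄
  have hσw : Valued.v (σ w) ≤ 1 := by rw [hd.vσ]; exact hwv
  have r1 : Valued.v (B₁ * ν⁻¹) < Valued.v ((A - b) * w + (D - b) * σ w) := by rw [map_mul, map_inv₀, hν, inv_one, mul_one]; exact hB₁M
  have r4 : Valued.v (ν * B₂ * (w * σ w)) < Valued.v ((A - b) * w + (D - b) * σ w) := by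
    rw [map_mul, map_mul, hν, one_mul, map_mul]
    exact lt_of_le_of_lt (mul_le_mul' le_rfl (mul_le_one' hwv hσw)) (by rw [mul_one]; exact hB₂M)
  have e : B₁ * ν⁻¹ + (A - b) * w + (D - b) * σ w + ν * B₂ * (w * σ w) = ((A - b) * w + (D - b) * σ w) + (B₁ * ν⁻¹ + ν * B₂ * (w * σ w)) := by ring
  have hrest : Valued.v (B₁ * ν⁻¹ + ν * B₂ * (w * σ w)) < Valued.v ((A - b) * w + (D - b) * σ w) :=
    lt_of_le_of_lt (Valuation.map_add _ _ _) (max_lt r1 r4)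
  rw [e, Valuation.map_add_eq_of_lt_left _ hrest] at h₄
  exact absurd (lt_of_lt_of_le htM h₄) (lt_irrefl _)

/-- **(R-norm) (4′) AS A NORM CONGRUENCE AT LEVEL `2m − N`**: with `|B₂| = |ϖ^N|`, `N ≤ 2m` and `|G − σG| ≤ |ϖ^{2m−N}|` (i.e. `2m ≤ M + N` in Flicker's letters):
`|E₄| ≤ |t|² ⟺ |XσX − r(s + r)| ≤ |ϖ^{2m−N}|` (twin of the (4)-half of ★ `conditions_iff_norm_sub_le_of_near`). [cite: Flicker1998UnitaryFL, Prop. 13 (c)(e) pp. 91–93] -/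
theorem corner_four_iff_norm_sub_le_trace (hd : UnramifiedLocalConjDatum σ ϖ) {A D b B₁ B₂ ν w s κ b₀ G r : K} {m N : ℕ}
    (hB : Valued.v B₂ = Valued.v (ϖ ^ N)) (hN : N ≤ 2 * m) (hν : Valued.v ν = 1) (hσν : σ ν = ν) (hws : w + σ w = s) (htr : κ + σ κ ≠ 0)
    (hb₀ : b₀ + σ b₀ = 1) (hb₀v : Valued.v b₀ ≤ 1) (hB₁ : B₁ = κ * σ κ * B₂) (hAD : A - D = (σ κ - κ) * B₂) (hG : B₂ * G = (D - b - κ * B₂) * s)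
    (hr : r * (κ + σ κ) = b₀ * G + σ b₀ * σ G) (hΔ : Valued.v (G - σ G) ≤ Valued.v (ϖ ^ (2 * m - N))) :
    Valued.v (B₁ * ν⁻¹ + (A - b) * w + (D - b) * σ w + ν * B₂ * (w * σ w)) ≤ Valued.v (ϖ ^ m) * Valued.v (ϖ ^ m) ↔
      Valued.v ((κ * ν⁻¹ + w + r) * σ (κ * ν⁻¹ + w + r) - r * (s + r)) ≤ Valued.v (ϖ ^ (2 * m - N)) := by
  have hB0 : B₂ ≠ 0 := fun h => by rw [h, map_zero] at hB; exact (pow_ne_zero N hd.ϖ_ne_zero) ((Valuation.zero_iff _).1 hB.symm)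
  have hBt : Valued.v B₂ * Valued.v (ϖ ^ (2 * m - N)) = Valued.v (ϖ ^ m) * Valued.v (ϖ ^ m) := by
    rw [hB, ← map_mul, ← map_mul, ← pow_add, ← pow_add, show N + (2 * m - N) = m + m by omega]
  have hvB_pos : 0 < Valued.v B₂ := (Valuation.pos_iff _).2 hB0
  have hΔ' : Valued.v B₂ * Valued.v (G - σ G) ≤ Valued.v (ϖ ^ m) * Valued.v (ϖ ^ m) := by rw [← hBt]; exact mul_le_mul' le_rfl hΔ
  rw [corner_four_iff_norm_sub_trace σ hd (b := b) hB0 hν hσν hws htr hb₀ hb₀v hB₁ hAD hG hr hΔ', ← hBt, mul_le_mul_iff_right₀ hvB_pos]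

/-- **(R-bd) THE BOUNDED REGIME AS A BALL IN `X`** (cases (b)(d), `2m ≤ M`): with `|B₂| = |ϖ^N|`, `N ≤ 2m`, `|G − σG| ≤ |ϖ^{2m−N}|` and `|r(s + r)| ≤ |ϖ^{2m−N}|`:
`|E₄| ≤ |t|² ⟺ |κν⁻¹ + w + r| ≤ |ϖ^{m−[N∕2]}|`. [cite: Flicker1998UnitaryFL, Prop. 13 (b)(d) pp. 91–93] -/
theorem corner_four_iff_v_le_of_bounded_trace (hd : UnramifiedLocalConjDatum σ ϖ) {A D b B₁ B₂ ν w s κ b₀ G r : K} {m N : ℕ}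
    (hB : Valued.v B₂ = Valued.v (ϖ ^ N)) (hN : N ≤ 2 * m) (hν : Valued.v ν = 1) (hσν : σ ν = ν) (hws : w + σ w = s) (htr : κ + σ κ ≠ 0)
    (hb₀ : b₀ + σ b₀ = 1) (hb₀v : Valued.v b₀ ≤ 1) (hB₁ : B₁ = κ * σ κ * B₂) (hAD : A - D = (σ κ - κ) * B₂) (hG : B₂ * G = (D - b - κ * B₂) * s)
    (hr : r * (κ + σ κ) = b₀ * G + σ b₀ * σ G) (hC : Valued.v (r * (s + r)) ≤ Valued.v (ϖ ^ (2 * m - N)))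
    (hΔ : Valued.v (G - σ G) ≤ Valued.v (ϖ ^ (2 * m - N))) :
    Valued.v (B₁ * ν⁻¹ + (A - b) * w + (D - b) * σ w + ν * B₂ * (w * σ w)) ≤ Valued.v (ϖ ^ m) * Valued.v (ϖ ^ m) ↔
      Valued.v (κ * ν⁻¹ + w + r) ≤ Valued.v (ϖ ^ (m - N / 2)) := by
  rw [corner_four_iff_norm_sub_le_trace σ hd (b := b) hB hN hν hσν hws htr hb₀ hb₀v hB₁ hAD hG hr hΔ, sub_eq_add_neg,
    v_add_le_iff_of_le (by rw [Valuation.map_neg]; exact hC), v_mul_map_le_pow_iff_trace σ hd _ (2 * m - N),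
    show (2 * m - N + 1) / 2 = m - N / 2 by omega]

/-- **(R-bd) THE BOUNDED REGIME AS A BOX IN `(ν⁻¹, x)`** (twin of ★ `conditions_iff_v_le_of_bounded`, fourth condition): in the coordinates `w = x + z` (`σx = −x`) and
`z + r = κw₀ + y₀` (`σw₀ = w₀`, `σy₀ = −y₀`, cf. `exists_eq_mul_fixed_add_anti`), with `|κ| ≤ 1`, `|κ + σκ| = 1` and the hypotheses of the ball form:
`|E₄| ≤ |t|² ⟺ |ν⁻¹ + w₀| ≤ |ϖ^{m−[N∕2]}| ∧ |x + y₀| ≤ |ϖ^{m−[N∕2]}|` — Flicker's «`(uū)⁻¹ ∈ −x + π^{m−[N∕2]}R`, `λ ∈ π^{m−[N∕2]}R`», a box of the same count.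
[cite: Flicker1998UnitaryFL, Prop. 13 (b)(d) pp. 91–93] -/
theorem corner_four_iff_box_of_bounded_trace (hd : UnramifiedLocalConjDatum σ ϖ) {A D b B₁ B₂ ν w s κ b₀ G r x z w₀ y₀ : K} {m N : ℕ}
    (hB : Valued.v B₂ = Valued.v (ϖ ^ N)) (hN : N ≤ 2 * m) (hν : Valued.v ν = 1) (hσν : σ ν = ν) (hws : w + σ w = s) (hκ : Valued.v κ ≤ 1)
    (htr : Valued.v (κ + σ κ) = 1) (hb₀ : b₀ + σ b₀ = 1) (hb₀v : Valued.v b₀ ≤ 1) (hB₁ : B₁ = κ * σ κ * B₂) (hAD : A - D = (σ κ - κ) * B₂)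
    (hG : B₂ * G = (D - b - κ * B₂) * s) (hr : r * (κ + σ κ) = b₀ * G + σ b₀ * σ G) (hC : Valued.v (r * (s + r)) ≤ Valued.v (ϖ ^ (2 * m - N)))
    (hΔ : Valued.v (G - σ G) ≤ Valued.v (ϖ ^ (2 * m - N))) (hw : w = x + z) (hσx : σ x = -x) (hc : z + r = κ * w₀ + y₀) (hσw₀ : σ w₀ = w₀)
    (hσy₀ : σ y₀ = -y₀) :
    Valued.v (B₁ * ν⁻¹ + (A - b) * w + (D - b) * σ w + ν * B₂ * (w * σ w)) ≤ Valued.v (ϖ ^ m) * Valued.v (ϖ ^ m) ↔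
      Valued.v (ν⁻¹ + w₀) ≤ Valued.v (ϖ ^ (m - N / 2)) ∧ Valued.v (x + y₀) ≤ Valued.v (ϖ ^ (m - N / 2)) := by
  have htr0 : κ + σ κ ≠ 0 := fun h => by rw [h, map_zero] at htr; exact zero_ne_one htr
  rw [corner_four_iff_v_le_of_bounded_trace σ hd (b := b) hB hN hν hσν hws htr0 hb₀ hb₀v hB₁ hAD hG hr hC hΔ,
    show κ * ν⁻¹ + w + r = κ * ν⁻¹ + x + (z + r) by rw [hw]; ring, hc,
    show κ * ν⁻¹ + x + (κ * w₀ + y₀) = κ * (ν⁻¹ + w₀) + (x + y₀) by ring,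
    v_mul_fixed_add_anti_le_iff σ hd.vσ (by rw [map_add, map_inv₀, hσν, hσw₀]) (by rw [map_add, hσx, hσy₀, neg_add]) hκ htr]

/-- **(R-ce) SIZE OF `X` IN THE NORM-RESIDUE REGIME**: if `|ϖ^a| < |C| ≤ |ϖ^{2k}|` and `|XσX − C| ≤ |ϖ^a|` then `|XσX| = |C|`, so `|X| ≤ |ϖ^k|` (the step of ★
`conditions_iff_norm_sub_le_of_near` that feeds (2′)(3′)). [cite: Flicker1998UnitaryFL, Prop. 13 (c)(e) pp. 92–93] -/
theorem v_le_pow_of_norm_sub_le_of_near_trace (hd : UnramifiedLocalConjDatum σ ϖ) {X C : K} {a k : ℕ} (hnear : Valued.v (ϖ ^ a) < Valued.v C)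
    (hfar : Valued.v C ≤ Valued.v (ϖ ^ (2 * k))) (h : Valued.v (X * σ X - C) ≤ Valued.v (ϖ ^ a)) : Valued.v X ≤ Valued.v (ϖ ^ k) := by
  have hXX : Valued.v (X * σ X) = Valued.v C := by
    rw [show X * σ X = (X * σ X - C) + C by ring]
    exact Valuation.map_add_eq_of_lt_right _ (lt_of_le_of_lt h hnear)
  have := (v_mul_map_le_pow_iff_trace σ hd X (2 * k)).1 (by rw [hXX]; exact hfar)
  rwa [show (2 * k + 1) / 2 = k by omega] at this

/-- **PARITY (the norm-residue obstruction, necessity; 2-free)**: `|ϖ^a| < |C|` and `|XσX − C| ≤ |ϖ^a|` force `|C| = |X|²`, so `ord C` is EVEN — Flicker's «there is a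
solution precisely when `M − N` is even»; sufficiency is `UnramifiedLocalConjDatum.norm` (used by the count). Twin of ★ `even_of_norm_sub_le_of_near` reading only `σ` isometric.
[cite: Flicker1998UnitaryFL, Prop. 13 (c)(e) pp. 92–93] [cite: Serre1979, Ch. V §2] -/
theorem even_of_norm_sub_le_of_near_trace (hvσ : ∀ y, Valued.v (σ y) = Valued.v y) {X C : K} {a : ℕ} (hnear : Valued.v (ϖ ^ a) < Valued.v C)
    (h : Valued.v (X * σ X - C) ≤ Valued.v (ϖ ^ a)) : ∃ e : ℤ, Valued.v C = WithZero.exp (2 * e) := by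
  have hXX : Valued.v (X * σ X) = Valued.v C := by
    rw [show X * σ X = (X * σ X - C) + C by ring]
    exact Valuation.map_add_eq_of_lt_right _ (lt_of_le_of_lt h hnear)
  have hC0 : Valued.v C ≠ 0 := ne_of_gt (lt_of_le_of_lt zero_le hnear)
  have hX0 : Valued.v X ≠ 0 := by
    intro h0
    rw [map_mul, hvσ, h0, zero_mul] at hXX; exact hC0 hXX.symm
  obtain ⟨e, he⟩ : ∃ e : ℤ, Valued.v X = WithZero.exp e := ⟨_, (WithZero.exp_log hX0).symm⟩
  exact ⟨e, by rw [← hXX, map_mul, hvσ, he, ← WithZero.exp_add, two_mul]⟩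

end UnitaryGroup

end Literature.NumberTheory.Automorphic
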